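import Summits.QuantumFields.BalabanUV.T4Continuum.Support.SkeletonFillFullNorms

/-!
# T⁴ programme, node NE3 — kinematic refinement lemma, leaf R1c∕R1d (row NE3-S4d), file F3b: the plaquette deviation
# ACROSS THE FAR FACE IN THE HIGHER DIRECTION (case III: `‖W(∂p) − 1‖ ≤ a₀ + 2(θ + La₀)(θ + θ_L) + d(L−1)δ`)

Cell `pub-balaban`, NE3 formalisation swarm, unit `b2b-balaban-t4-ne3-formalise-leaf-07` (LEAF PROVER 07), row **S4d** of
`t4/formal/NE3/LEAVES.md`; continuation of `SkeletonFillFullNorms` (F3a: word calculus, sizes, cases I–II) for the word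
`SkeletonFillFull.hol_plaq_fullFill_farν` (F2).  SHAPE `t4/formal/NE3/Statements/S4d-SHAPE-v1.md` §3.

THE MECHANISM (case III, `μ < ν`, `q_ν = L − 1 > q_μ`…).  The word is `A·(BΛ′)·(Ad_T A♯)⁻¹·(BΛ)⁻¹` with `A = Hμ(z,q)`,
`B = Hν(z,q)`, `Λ = Lν(z,q)`, `Λ′ = Lν(z,q+e_μ)`, `A♯ = Hμ(z+e_ν, q+e_ν−Le_ν)`, `T = T(z,ν)`; hence
`‖W(∂p) − 1‖ = ‖A·BΛ′ − BΛ·Ã‖`, `Ã = TA♯T⁻¹`.  Splitting the ordered products at the one index where they differ —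
`A = A₁·(g^{L−1})⁻¹·A₂`, `Ã ≈ Ã₁Ã₂ ≈ A₁A₂` (the `ν`-slot of `A♯` has exponent `0`; the other slots are the block's roots
transported by `T`, within `(L−1)δ` each), `Λ′ = Λ_a·g^{(k+1)L}·Λ_b` against `Λ = Λ_a·g^{kL}·Λ_b` (`g = h(z;μ,ν)`,
`k = q_μ`) — the abelian tally is `g^{L}·g^{−(L−1)} = g`: after two commutator moves the two sides differ by exactly one
root `g` and the transported-root defects.

CONTENT (all [folklore]; `Matrix n n ℂ`; 0 sorry): §1 splitting lemmas `hiProd_split`∕`loProd_split` (the row ∕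
compensating product with ONE factor exposed), the transported partial products (`norm_conj_prodOver_powInv_sub_le`);
§2 **`norm_plaq_farν_sub_one_le`** (case III).  Case IV (the far corner, where the chain plaquette `T(∂p) = h^{L²}` enters)
and the `SmallField` assembly are file F3c (`SkeletonFillFullSmall`).

HONEST FRAMING.  Norm bookkeeping for a kinematic construction; no minimiser, no conditional of the cell (`BetaPertH`, (B),
(B^μ)); nothing bears on infinite volume, a mass gap, or the Clay problem; **NE3 is NOT proved** (one leaf of the kinematic
lemma `SmoothRefine` ∕ `ApproxRefine`, ours, unproved).  Finite T⁴ rung (B)+1.  ABSOLUTE RULE kept: no printed sentence is a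
hypothesis; no `def … : Prop` fact; no `sorry`, axioms ⊆ {propext, Classical.choice, Quot.sound}.  PLACEMENT (human rule
2026-08-19): under `Summits/QuantumFields/BalabanUV/`; imports F3a only; moves nothing.
-/

set_option autoImplicit false

open scoped BigOperators Matrix Matrix.Norms.L2Operator
open NormedSpace

namespace Summit.QuantumFields.BalabanUV.T4Continuum.SkeletonFillFullFaces

open Literature.MathematicalPhysics.QuantumFieldTheory.Balaban1983to89
open B7Prop1Explicit B7Prop2Explicit B7Prop1Local MatrixLog UnitaryModel
open T4AveragingDeficitWall hiding Site Plane Plaq Bond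
open AveragingDeficitTransport AveragingDeficitNearIdentity GaugeFieldPerturbation
open SkeletonLattice SkeletonFill SkeletonFillFull SkeletonFillFullNorms

noncomputable section

variable {d : ℕ} {n : Type*} [Fintype n] [DecidableEq n]

/-! ## §1 Splitting the row and compensating products at one index; transported partial products -/

section Split

variable {G : Type*} [Group G]

/-- **THE ROW PRODUCT WITH THE `ν`-FACTOR EXPOSED** (`μ < ν`): `Hμ(z,q) = P₁ · (h(z;μ,ν)^{q_ν})⁻¹ · P₂`, the partial
products `P₁, P₂` running over directions `≠ ν` (so they do not read `q_ν` and do not contain `h(z;μ,ν)`). [folklore] -/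
theorem hiProd_split (h : Site d → Fin d → Fin d → G) {μ ν : Fin d} (hμν : μ < ν) :
    ∃ l₁ l₂ : List (Fin d), ν ∉ l₁ ∧ ν ∉ l₂ ∧ (∀ i ∈ l₁ ++ l₂, μ < i) ∧ l₁.length + l₂.length + 1 = (above μ).length ∧
      ∀ (z q : Site d), hiProd h z q μ
        = prodOver l₁ (fun i => ((h z μ i) ^ (q i).toNat)⁻¹) * ((h z μ ν) ^ (q ν).toNat)⁻¹
          * prodOver l₂ (fun i => ((h z μ i) ^ (q i).toNat)⁻¹) := by
  obtain ⟨l₁, l₂, hl, h₁, h₂, hsplit⟩ := prodOver_split (G := G) (nodup_above μ) (mem_above.mpr hμν)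
  refine ⟨l₁, l₂, h₁, h₂, fun i hi => ?_, ?_, fun z q => hsplit _⟩
  · have : i ∈ above μ := by
      rw [hl]; rcases List.mem_append.mp hi with h | h
      · exact List.mem_append_left _ h
      · exact List.mem_append_right _ (List.mem_cons_of_mem _ h)
    exact mem_above.mp this
  · have := congrArg List.length hl; simp only [List.length_append, List.length_cons] at this; omega

/-- **THE COMPENSATING PRODUCT WITH THE `κ`-FACTOR EXPOSED** (`κ < μ`): `Lμ(z,q) = Q₁ · h(z;κ,μ)^{q_κ L} · Q₂`. [folklore] -/
theorem loProd_split (L : ℕ) (h : Site d → Fin d → Fin d → G) {κ μ : Fin d} (hκμ : κ < μ) :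
    ∃ l₁ l₂ : List (Fin d), κ ∉ l₁ ∧ κ ∉ l₂ ∧ (∀ i ∈ l₁ ++ l₂, i < μ) ∧ l₁.length + l₂.length + 1 = (below μ).length ∧
      ∀ (z q : Site d), loProd L h z q μ
        = prodOver l₁ (fun i => (h z i μ) ^ ((q i).toNat * L)) * (h z κ μ) ^ ((q κ).toNat * L)
          * prodOver l₂ (fun i => (h z i μ) ^ ((q i).toNat * L)) := by
  obtain ⟨l₁, l₂, hl, h₁, h₂, hsplit⟩ := prodOver_split (G := G) (nodup_below μ) (mem_below.mpr hκμ)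
  refine ⟨l₁, l₂, h₁, h₂, fun i hi => ?_, ?_, fun z q => hsplit _⟩
  · have : i ∈ below μ := by
      rw [hl]; rcases List.mem_append.mp hi with h | h
      · exact List.mem_append_left _ h
      · exact List.mem_append_right _ (List.mem_cons_of_mem _ h)
    exact mem_below.mp this
  · have := congrArg List.length hl; simp only [List.length_append, List.length_cons] at this; omega

/-- The lists `above μ`, `below μ` have at most `d` entries. [folklore] -/
theorem length_above_le (μ : Fin d) : (above μ).length ≤ d := by
  have := List.length_filter_le (fun ν => decide (μ < ν)) (List.finRange d)
  rw [List.length_finRange] at this; exact this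

/-- The lists `above μ`, `below μ` have at most `d` entries. [folklore] -/
theorem length_below_le (μ : Fin d) : (below μ).length ≤ d := by
  have := List.length_filter_le (fun κ => decide (κ < μ)) (List.finRange d)
  rw [List.length_finRange] at this; exact this

end Split

section Transported

variable [Nonempty n] {L : ℕ} {δ : ℝ}

omit [Nonempty n] in
/-- **SWAP STEP** inside a unitary frame: `‖p·xy·s − p·yx·s‖ ≤ 2‖x − 1‖‖y − 1‖`. [folklore] -/
theorem norm_val_swap_le {p s : (Matrix n n ℂ)ˣ} (hp : p ∈ unitaryUnits (Matrix n n ℂ)) (hs : s ∈ unitaryUnits (Matrix n n ℂ)) (x y : (Matrix n n ℂ)ˣ) :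
    ‖((p * (x * y) * s : (Matrix n n ℂ)ˣ) : (Matrix n n ℂ)) - ((p * (y * x) * s : (Matrix n n ℂ)ˣ) : (Matrix n n ℂ))‖ ≤ 2 * ‖(x : (Matrix n n ℂ)) - 1‖ * ‖(y : (Matrix n n ℂ)) - 1‖ := by
  rw [norm_val_frame_sub hp hs, Units.val_mul, Units.val_mul]
  exact norm_comm_le _ _

/-- **TRANSPORTED PARTIAL ROW PRODUCTS**: `‖t·Π_l ((h′_i)^{k_i})⁻¹·t⁻¹ − Π_l (h_i^{k_i})⁻¹‖ ≤ |l|·K·δ` if every transported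
root `t h′_i t⁻¹` is within `δ` of `h_i` and the exponents are `≤ K`. [folklore] -/
theorem norm_conj_prodOver_powInv_sub_le {l : List (Fin d)} {g g' : Fin d → (Matrix n n ℂ)ˣ} {k : Fin d → ℕ} {K : ℕ}
    (hg : ∀ i, g i ∈ unitaryUnits (Matrix n n ℂ)) (hg' : ∀ i, g' i ∈ unitaryUnits (Matrix n n ℂ)) {t : (Matrix n n ℂ)ˣ} (ht : t ∈ unitaryUnits (Matrix n n ℂ))
    (hδ : ∀ i ∈ l, ‖((t * g' i * t⁻¹ : (Matrix n n ℂ)ˣ) : (Matrix n n ℂ)) - (g i : (Matrix n n ℂ))‖ ≤ δ) (hk : ∀ i ∈ l, k i ≤ K) :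
    ‖((t * prodOver l (fun i => ((g' i) ^ k i)⁻¹) * t⁻¹ : (Matrix n n ℂ)ˣ) : (Matrix n n ℂ)) - ((prodOver l (fun i => ((g i) ^ k i)⁻¹) : (Matrix n n ℂ)ˣ) : (Matrix n n ℂ))‖
      ≤ l.length * (K * δ) := by
  rw [conj_prodOver]
  simp only [conj_pow_inv]
  have htu : ∀ i, t * g' i * t⁻¹ ∈ unitaryUnits (Matrix n n ℂ) := fun i =>
    (unitaryUnits (Matrix n n ℂ)).mul_mem ((unitaryUnits (Matrix n n ℂ)).mul_mem ht (hg' _)) ((unitaryUnits (Matrix n n ℂ)).inv_mem ht)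
  refine norm_val_prodOver_sub_prodOver_le
    (fun i _ => (unitaryUnits (Matrix n n ℂ)).inv_mem ((unitaryUnits (Matrix n n ℂ)).pow_mem (htu _) _))
    (fun i _ => (unitaryUnits (Matrix n n ℂ)).inv_mem ((unitaryUnits (Matrix n n ℂ)).pow_mem (hg _) _)) fun i hi => ?_
  rw [norm_val_inv_sub_inv ((unitaryUnits (Matrix n n ℂ)).pow_mem (htu _) _) ((unitaryUnits (Matrix n n ℂ)).pow_mem (hg _) _)]
  refine (norm_val_pow_sub_pow_le (htu _) (hg _) _).trans ?_
  exact mul_le_mul (by exact_mod_cast hk i hi) (hδ i hi) (norm_nonneg _) (by positivity)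

/-- **TRANSPORTED PARTIAL COMPENSATING PRODUCTS**: the same for the positive powers `h^{k L}`. [folklore] -/
theorem norm_conj_prodOver_pow_sub_le {l : List (Fin d)} {g g' : Fin d → (Matrix n n ℂ)ˣ} {k : Fin d → ℕ} {K : ℕ}
    (hg : ∀ i, g i ∈ unitaryUnits (Matrix n n ℂ)) (hg' : ∀ i, g' i ∈ unitaryUnits (Matrix n n ℂ)) {t : (Matrix n n ℂ)ˣ} (ht : t ∈ unitaryUnits (Matrix n n ℂ))
    (hδ : ∀ i ∈ l, ‖((t * g' i * t⁻¹ : (Matrix n n ℂ)ˣ) : (Matrix n n ℂ)) - (g i : (Matrix n n ℂ))‖ ≤ δ) (hk : ∀ i ∈ l, k i ≤ K) :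
    ‖((t * prodOver l (fun i => (g' i) ^ k i) * t⁻¹ : (Matrix n n ℂ)ˣ) : (Matrix n n ℂ)) - ((prodOver l (fun i => (g i) ^ k i) : (Matrix n n ℂ)ˣ) : (Matrix n n ℂ))‖
      ≤ l.length * (K * δ) := by
  rw [conj_prodOver]
  simp only [SkeletonFillFullNorms.conj_pow]
  have htu : ∀ i, t * g' i * t⁻¹ ∈ unitaryUnits (Matrix n n ℂ) := fun i =>
    (unitaryUnits (Matrix n n ℂ)).mul_mem ((unitaryUnits (Matrix n n ℂ)).mul_mem ht (hg' _)) ((unitaryUnits (Matrix n n ℂ)).inv_mem ht)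
  refine norm_val_prodOver_sub_prodOver_le (fun i _ => (unitaryUnits (Matrix n n ℂ)).pow_mem (htu _) _)
    (fun i _ => (unitaryUnits (Matrix n n ℂ)).pow_mem (hg _) _) fun i hi => ?_
  refine (norm_val_pow_sub_pow_le (htu _) (hg _) _).trans ?_
  exact mul_le_mul (by exact_mod_cast hk i hi) (hδ i hi) (norm_nonneg _) (by positivity)

end Transported

/-! ## §2 Case III: the far face in the higher direction -/

section CaseIII

variable [Nonempty n] {L : ℕ} {a₀ δ : ℝ}

/-- **CASE III (FAR FACE IN `ν`)**: for `μ < ν`, `q_ν = L − 1`, `q_μ < L − 1` (other offsets arbitrary),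
`‖W(∂p) − 1‖ ≤ a₀ + 2(θ + La₀)(θ + θ_L) + d(L−1)δ` with `θ = d(L−1)a₀`, `θ_L = d(L−1)L a₀` and `δ` the covariant root
gradient across the coarse bond `(z, ν)`. [folklore] -/
theorem norm_plaq_farν_sub_one_le (hL : 1 ≤ L) {T : Site d → Fin d → (Matrix n n ℂ)ˣ} {h : Site d → Fin d → Fin d → (Matrix n n ℂ)ˣ}
    (hT : ∀ (z : Site d) (κ : Fin d), T z κ ∈ unitaryUnits (Matrix n n ℂ))
    (hh : ∀ (z : Site d) (κ ν : Fin d), h z κ ν ∈ unitaryUnits (Matrix n n ℂ))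
    (ha : ∀ (z : Site d) (κ ν : Fin d), κ < ν → ‖((h z κ ν : (Matrix n n ℂ)ˣ) : (Matrix n n ℂ)) - 1‖ ≤ a₀) (ha0 : 0 ≤ a₀)
    {z : Site d} {ν : Fin d}
    (hδ : ∀ κ ι : Fin d, κ < ι →
      ‖((T z ν * h (z + e ν) κ ι * (T z ν)⁻¹ : (Matrix n n ℂ)ˣ) : (Matrix n n ℂ)) - ((h z κ ι : (Matrix n n ℂ)ˣ) : (Matrix n n ℂ))‖ ≤ δ) (hδ0 : 0 ≤ δ)
    {q : Site d} (hq : InBox L q) {μ : Fin d} (hμν : μ < ν) (hμ : q μ < (L : ℤ) - 1) (hν : q ν = (L : ℤ) - 1) :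
    ‖((hol (fullFill L T h) ((L : ℤ) • z + q) (plaqWord μ ν) : (Matrix n n ℂ)ˣ) : (Matrix n n ℂ)) - 1‖
      ≤ a₀ + 2 * (d * ((L - 1 : ℕ) * a₀) + L * a₀) * (d * ((L - 1 : ℕ) * a₀) + d * (((L - 1 : ℕ) * L) * a₀))
        + d * ((L - 1 : ℕ) * δ) := by
  -- unitarity bookkeeping
  have hF : ∀ (z' q' : Site d) (κ i : Fin d), ((h z' κ i) ^ (q' i).toNat)⁻¹ ∈ unitaryUnits (Matrix n n ℂ) := fun _ _ _ _ =>
    (unitaryUnits (Matrix n n ℂ)).inv_mem ((unitaryUnits (Matrix n n ℂ)).pow_mem (hh _ _ _) _)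
  have hGm : ∀ (z' q' : Site d) (i κ : Fin d), (h z' i κ) ^ ((q' i).toNat * L) ∈ unitaryUnits (Matrix n n ℂ) := fun _ _ _ _ =>
    (unitaryUnits (Matrix n n ℂ)).pow_mem (hh _ _ _) _
  have huA : ∀ (z' q' : Site d) (κ : Fin d), hiProd h z' q' κ ∈ unitaryUnits (Matrix n n ℂ) := fun _ _ _ =>
    prodOver_mem fun i _ => hF _ _ _ _
  have huL : ∀ (z' q' : Site d) (κ : Fin d), loProd L h z' q' κ ∈ unitaryUnits (Matrix n n ℂ) := fun _ _ _ =>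
    prodOver_mem fun i _ => hGm _ _ _ _
  have U := unitaryUnits (Matrix n n ℂ)
  -- names
  set A := hiProd h z q μ with hAdef
  set B := hiProd h z q ν with hBdef
  set Λ := loProd L h z q ν with hΛdef
  set Λ' := loProd L h z (q + e μ) ν with hΛ'def
  set t := T z ν with htdef
  set As := hiProd h (z + e ν) (q + e ν - (L : ℤ) • e ν) μ with hAsdef
  set g := h z μ ν with hgdef
  have hgu : g ∈ unitaryUnits (Matrix n n ℂ) := hh _ _ _
  -- the word, regrouped as `A (BΛ') (t As t⁻¹)⁻¹ (BΛ)⁻¹`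
  have hword : hiProd h z q μ * (hiProd h z q ν * (loProd L h z (q + e μ) ν * T z ν))
      * (hiProd h (z + e ν) (q + e ν - (L : ℤ) • e ν) μ)⁻¹ * ((loProd L h z q ν * T z ν)⁻¹ * (hiProd h z q ν)⁻¹)
      = A * (B * Λ') * (t * As * t⁻¹)⁻¹ * (B * Λ)⁻¹ := by
    simp only [hAdef, hBdef, hΛdef, hΛ'def, htdef, hAsdef]; group
  have huAs : t * As * t⁻¹ ∈ unitaryUnits (Matrix n n ℂ) :=
    (unitaryUnits (Matrix n n ℂ)).mul_mem ((unitaryUnits (Matrix n n ℂ)).mul_mem (hT _ _) (huA _ _ _)) ((unitaryUnits (Matrix n n ℂ)).inv_mem (hT _ _))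
  rw [hol_plaq_fullFill_farν hL hq hμν hμ hν, hword,
    norm_val_plaq4_sub_one huAs ((unitaryUnits (Matrix n n ℂ)).mul_mem (huA _ _ _) (huL _ _ _))]
  -- splits: `A` at `ν`, `Λ`/`Λ'` at `μ`
  obtain ⟨l₁, l₂, hν₁, hν₂, hl₁₂, hlen, hHsplit⟩ := hiProd_split (G := (Matrix n n ℂ)ˣ) h hμν
  obtain ⟨m₁, m₂, hμ₁, hμ₂, hm₁₂, hmlen, hLsplit⟩ := loProd_split (G := (Matrix n n ℂ)ˣ) L h hμν
  set F : Fin d → (Matrix n n ℂ)ˣ := fun i => ((h z μ i) ^ (q i).toNat)⁻¹ with hFdef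
  set A₁ := prodOver l₁ F with hA₁def
  set A₂ := prodOver l₂ F with hA₂def
  have hA : A = A₁ * (g ^ (q ν).toNat)⁻¹ * A₂ := hHsplit z q
  -- the neighbour's row product, transported: `t As t⁻¹ = Ã₁ Ã₂`
  set F' : Fin d → (Matrix n n ℂ)ˣ := fun i => ((h (z + e ν) μ i) ^ ((q + e ν - (L : ℤ) • e ν) i).toNat)⁻¹ with hF'def
  have hF'ν : F' ν = 1 := by
    simp only [hF'def, Pi.add_apply, Pi.sub_apply, Pi.smul_apply, e_apply, if_true, smul_eq_mul, mul_one, hν]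
    norm_num
  have hF'off : ∀ i, i ≠ ν → F' i = ((h (z + e ν) μ i) ^ (q i).toNat)⁻¹ := fun i hi => by
    simp only [hF'def, Pi.add_apply, Pi.sub_apply, Pi.smul_apply, e_apply, if_neg hi, smul_eq_mul, mul_zero,
      add_zero, sub_zero]
  have hmid : ((h (z + e ν) μ ν) ^ ((q + e ν - (L : ℤ) • e ν) ν).toNat)⁻¹ = 1 := by
    simp only [Pi.add_apply, Pi.sub_apply, Pi.smul_apply, e_apply, if_true, smul_eq_mul, mul_one, hν]
    norm_num
  have hAs : As = prodOver l₁ F' * prodOver l₂ F' := by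
    rw [hAsdef, hHsplit (z + e ν) (q + e ν - (L : ℤ) • e ν), hmid, mul_one]
  set At₁ := t * prodOver l₁ F' * t⁻¹ with hAt₁def
  set At₂ := t * prodOver l₂ F' * t⁻¹ with hAt₂def
  have hAt : t * As * t⁻¹ = At₁ * At₂ := by rw [hAs, hAt₁def, hAt₂def]; group
  -- `Λ = Λa g^{kL} Λb`, `Λ' = Λa g^{(k+1)L} Λb`
  set Gf : Fin d → (Matrix n n ℂ)ˣ := fun i => (h z i ν) ^ ((q i).toNat * L) with hGfdef
  set Λa := prodOver m₁ Gf with hΛadef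
  set Λb := prodOver m₂ Gf with hΛbdef
  have hΛ : Λ = Λa * g ^ ((q μ).toNat * L) * Λb := hLsplit z q
  have hΛ' : Λ' = Λa * g ^ (((q μ).toNat + 1) * L) * Λb := by
    have h1 := hLsplit z (q + e μ)
    have hagree : ∀ i, i ≠ μ → (h z i ν) ^ (((q + e μ) i).toNat * L) = Gf i := fun i hi => by
      simp only [hGfdef, Pi.add_apply, e_apply, if_neg hi, add_zero]
    rw [prodOver_congr (fun i hi => hagree i (fun he => hμ₁ (he ▸ hi))),
      prodOver_congr (fun i hi => hagree i (fun he => hμ₂ (he ▸ hi))), toNat_add_e_self (hq μ).1] at h1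
    exact h1
  -- exponent bookkeeping: `(q ν).toNat = L - 1`, `g^L (g^{L-1})⁻¹ = g`
  have hm : (q ν).toNat = L - 1 := by have := (hq ν).1; omega
  have hpow : g ^ (((q μ).toNat + 1) * L) = g ^ ((q μ).toNat * L) * g ^ L := by rw [← pow_add]; ring_nf
  have hgL : g ^ L * (g ^ (q ν).toNat)⁻¹ = g := by
    rw [hm]
    obtain ⟨m, rfl⟩ : ∃ m, L = m + 1 := ⟨L - 1, by omega⟩
    rw [show m + 1 - 1 = m by omega, pow_succ']; group
  -- unitarity of the pieces
  have huF : ∀ i, F i ∈ unitaryUnits (Matrix n n ℂ) := fun i => hF _ _ _ _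
  have huF' : ∀ i, F' i ∈ unitaryUnits (Matrix n n ℂ) := fun i => hF _ _ _ _
  have huGf : ∀ i, Gf i ∈ unitaryUnits (Matrix n n ℂ) := fun i => hGm _ _ _ _
  have huA₁ : A₁ ∈ unitaryUnits (Matrix n n ℂ) := prodOver_mem fun i _ => huF i
  have huA₂ : A₂ ∈ unitaryUnits (Matrix n n ℂ) := prodOver_mem fun i _ => huF i
  have huΛa : Λa ∈ unitaryUnits (Matrix n n ℂ) := prodOver_mem fun i _ => huGf i
  have huΛb : Λb ∈ unitaryUnits (Matrix n n ℂ) := prodOver_mem fun i _ => huGf i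
  have huAt₁ : At₁ ∈ unitaryUnits (Matrix n n ℂ) := (unitaryUnits (Matrix n n ℂ)).mul_mem ((unitaryUnits (Matrix n n ℂ)).mul_mem (hT _ _)
    (prodOver_mem fun i _ => huF' i)) ((unitaryUnits (Matrix n n ℂ)).inv_mem (hT _ _))
  have huAt₂ : At₂ ∈ unitaryUnits (Matrix n n ℂ) := (unitaryUnits (Matrix n n ℂ)).mul_mem ((unitaryUnits (Matrix n n ℂ)).mul_mem (hT _ _)
    (prodOver_mem fun i _ => huF' i)) ((unitaryUnits (Matrix n n ℂ)).inv_mem (hT _ _))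
  have hugk : ∀ k : ℕ, g ^ k ∈ unitaryUnits (Matrix n n ℂ) := fun k => (unitaryUnits (Matrix n n ℂ)).pow_mem hgu k
  -- sizes
  set θ : ℝ := d * ((L - 1 : ℕ) * a₀) with hθdef
  set θL : ℝ := d * (((L - 1 : ℕ) * L) * a₀) with hθLdef
  have hθ0 : 0 ≤ θ := by positivity
  have hθL0 : 0 ≤ θL := by positivity
  have hθA : ‖(A : (Matrix n n ℂ)) - 1‖ ≤ θ := norm_hiProd_sub_one_le hh ha ha0 z hq μ
  have hθB : ‖(B : (Matrix n n ℂ)) - 1‖ ≤ θ := norm_hiProd_sub_one_le hh ha ha0 z hq ν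
  have hθΛ' : ‖(Λ' : (Matrix n n ℂ)) - 1‖ ≤ θL := norm_loProd_sub_one_le hh ha ha0 z (inBox_add_e hq hμ) ν
  have hfac : ∀ i, μ < i → ‖(F i : (Matrix n n ℂ)) - 1‖ ≤ (L - 1 : ℕ) * a₀ := fun i hi => by
    rw [hFdef]; dsimp only
    rw [norm_val_inv_sub_one ((unitaryUnits (Matrix n n ℂ)).pow_mem (hh _ _ _) _)]
    refine (norm_val_pow_sub_one_le (hh _ _ _) _).trans ?_
    exact mul_le_mul (by exact_mod_cast toNat_le_of_inBox hq i) (ha _ _ _ hi) (norm_nonneg _) (by positivity)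
  have hθA₁ : ‖(A₁ : (Matrix n n ℂ)) - 1‖ ≤ l₁.length * ((L - 1 : ℕ) * a₀) :=
    norm_val_prodOver_sub_one_le (fun i _ => huF i) fun i hi => hfac i (hl₁₂ i (List.mem_append_left _ hi))
  have hgfac : ∀ i, i < ν → ‖(Gf i : (Matrix n n ℂ)) - 1‖ ≤ ((L - 1 : ℕ) * L) * a₀ := fun i hi => by
    rw [hGfdef]; dsimp only
    refine (norm_val_pow_sub_one_le (hh _ _ _) _).trans ?_
    push_cast
    exact mul_le_mul (by exact_mod_cast Nat.mul_le_mul_right L (toNat_le_of_inBox hq i)) (ha _ _ _ hi)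
      (norm_nonneg _) (by positivity)
  have hθΛb : ‖(Λb : (Matrix n n ℂ)) - 1‖ ≤ m₂.length * (((L - 1 : ℕ) * L) * a₀) :=
    norm_val_prodOver_sub_one_le (fun i _ => huGf i) fun i hi => hgfac i (hm₁₂ i (List.mem_append_right _ hi))
  have hl₁d : (l₁.length : ℝ) ≤ d := by have := length_above_le μ; exact_mod_cast (by omega : l₁.length ≤ d)
  have hm₂d : (m₂.length : ℝ) ≤ d := by have := length_below_le ν; exact_mod_cast (by omega : m₂.length ≤ d)
  have hθA₁' : ‖(A₁ : (Matrix n n ℂ)) - 1‖ ≤ θ := hθA₁.trans (by rw [hθdef]; exact mul_le_mul_of_nonneg_right hl₁d (by positivity))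
  have hθΛb' : ‖(Λb : (Matrix n n ℂ)) - 1‖ ≤ θL :=
    hθΛb.trans (by rw [hθLdef]; exact mul_le_mul_of_nonneg_right hm₂d (by positivity))
  have hgL1 : ‖((g ^ L : (Matrix n n ℂ)ˣ) : (Matrix n n ℂ)) - 1‖ ≤ L * a₀ :=
    (norm_val_pow_sub_one_le hgu L).trans (mul_le_mul_of_nonneg_left (ha _ _ _ hμν) (by positivity))
  -- the transported pieces are `δ`-close
  have hδ₁ : ‖(At₁ : (Matrix n n ℂ)) - (A₁ : (Matrix n n ℂ))‖ ≤ l₁.length * ((L - 1 : ℕ) * δ) := by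
    rw [hAt₁def, hA₁def, prodOver_congr (fun i hi => hF'off i (fun he => hν₁ (he ▸ hi)))]
    exact norm_conj_prodOver_powInv_sub_le (k := fun i => (q i).toNat) (fun i => hh z μ i)
      (fun i => hh (z + e ν) μ i) (hT _ _) (fun i hi => hδ μ i (hl₁₂ i (List.mem_append_left _ hi)))
      (fun i _ => toNat_le_of_inBox hq i)
  have hδ₂ : ‖(At₂ : (Matrix n n ℂ)) - (A₂ : (Matrix n n ℂ))‖ ≤ l₂.length * ((L - 1 : ℕ) * δ) := by
    rw [hAt₂def, hA₂def, prodOver_congr (fun i hi => hF'off i (fun he => hν₂ (he ▸ hi)))]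
    exact norm_conj_prodOver_powInv_sub_le (k := fun i => (q i).toNat) (fun i => hh z μ i)
      (fun i => hh (z + e ν) μ i) (hT _ _) (fun i hi => hδ μ i (hl₁₂ i (List.mem_append_right _ hi)))
      (fun i _ => toNat_le_of_inBox hq i)
  have hδ₁₂ : ‖((At₁ * At₂ : (Matrix n n ℂ)ˣ) : (Matrix n n ℂ)) - ((A₁ * A₂ : (Matrix n n ℂ)ˣ) : (Matrix n n ℂ))‖ ≤ d * ((L - 1 : ℕ) * δ) := by
    rw [Units.val_mul, Units.val_mul]
    refine (norm_mul_sub_mul_le_of_norm_le_one (norm_val_of_unitary huAt₂).le (norm_val_of_unitary huA₁).le).trans ?_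
    refine (add_le_add hδ₁ hδ₂).trans ?_
    rw [← add_mul]
    refine mul_le_mul_of_nonneg_right ?_ (by positivity)
    have := length_above_le μ
    exact_mod_cast (by omega : l₁.length + l₂.length ≤ d)
  -- THE CHAIN: `‖A·BΛ' − BΛ·Ã‖`
  have step1 : ‖((A * (B * Λ') : (Matrix n n ℂ)ˣ) : (Matrix n n ℂ)) - ((B * Λ' * A : (Matrix n n ℂ)ˣ) : (Matrix n n ℂ))‖ ≤ 2 * θ * (θ + θL) := by
    have e1 : (A * (B * Λ') : (Matrix n n ℂ)ˣ) = 1 * (A * (B * Λ')) * 1 := by group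
    have e2 : (B * Λ' * A : (Matrix n n ℂ)ˣ) = 1 * ((B * Λ') * A) * 1 := by group
    rw [e1, e2]
    refine (norm_val_swap_le (unitaryUnits (Matrix n n ℂ)).one_mem (unitaryUnits (Matrix n n ℂ)).one_mem _ _).trans ?_
    have hBΛ' : ‖((B * Λ' : (Matrix n n ℂ)ˣ) : (Matrix n n ℂ)) - 1‖ ≤ θ + θL := by
      rw [Units.val_mul]
      exact (B8Ineq170.norm_mul_sub_one_le_of_norm_le_one (norm_val_of_unitary (huA _ _ _)).le).trans
        (add_le_add hθB hθΛ')
    have := mul_le_mul hθA hBΛ' (norm_nonneg _) hθ0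
    nlinarith [this, norm_nonneg ((A : (Matrix n n ℂ)) - 1), norm_nonneg (((B * Λ' : (Matrix n n ℂ)ˣ) : (Matrix n n ℂ)) - 1)]
  -- rewrite both words through the splits: `B Λ' A = (B Λa g^{kL}) (g^L (Λb A₁) ((g^m)⁻¹ A₂))`,
  -- `B Λ Ã = (B Λa g^{kL}) (Λb Ã₁ Ã₂)`
  have eX : (B * Λ' * A : (Matrix n n ℂ)ˣ) = (B * Λa * g ^ ((q μ).toNat * L)) * (g ^ L * (Λb * A₁) * ((g ^ (q ν).toNat)⁻¹ * A₂)) := by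
    rw [hΛ', hA, hpow]; group
  have eY : (B * Λ * (t * As * t⁻¹) : (Matrix n n ℂ)ˣ) = (B * Λa * g ^ ((q μ).toNat * L)) * (Λb * At₁ * At₂) := by
    rw [hΛ, hAt]; group
  have huPre : B * Λa * g ^ ((q μ).toNat * L) ∈ unitaryUnits (Matrix n n ℂ) :=
    (unitaryUnits (Matrix n n ℂ)).mul_mem ((unitaryUnits (Matrix n n ℂ)).mul_mem (huA _ _ _) huΛa) (hugk _)
  have step2 : ‖((g ^ L * (Λb * A₁) * ((g ^ (q ν).toNat)⁻¹ * A₂) : (Matrix n n ℂ)ˣ) : (Matrix n n ℂ))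
      - (((Λb * A₁) * g ^ L * ((g ^ (q ν).toNat)⁻¹ * A₂) : (Matrix n n ℂ)ˣ) : (Matrix n n ℂ))‖ ≤ 2 * (L * a₀) * (θL + θ) := by
    have e1 : (g ^ L * (Λb * A₁) * ((g ^ (q ν).toNat)⁻¹ * A₂) : (Matrix n n ℂ)ˣ)
        = 1 * (g ^ L * (Λb * A₁)) * ((g ^ (q ν).toNat)⁻¹ * A₂) := by group
    have e2 : ((Λb * A₁) * g ^ L * ((g ^ (q ν).toNat)⁻¹ * A₂) : (Matrix n n ℂ)ˣ)
        = 1 * ((Λb * A₁) * g ^ L) * ((g ^ (q ν).toNat)⁻¹ * A₂) := by group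
    rw [e1, e2]
    refine (norm_val_swap_le (unitaryUnits (Matrix n n ℂ)).one_mem ((unitaryUnits (Matrix n n ℂ)).mul_mem
      ((unitaryUnits (Matrix n n ℂ)).inv_mem (hugk _)) huA₂) _ _).trans ?_
    have hΛbA₁ : ‖((Λb * A₁ : (Matrix n n ℂ)ˣ) : (Matrix n n ℂ)) - 1‖ ≤ θL + θ := by
      rw [Units.val_mul]
      exact (B8Ineq170.norm_mul_sub_one_le_of_norm_le_one (norm_val_of_unitary huΛb).le).trans (add_le_add hθΛb' hθA₁')
    have := mul_le_mul hgL1 hΛbA₁ (norm_nonneg _) (by positivity)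
    nlinarith [this, norm_nonneg (((g ^ L : (Matrix n n ℂ)ˣ) : (Matrix n n ℂ)) - 1), norm_nonneg (((Λb * A₁ : (Matrix n n ℂ)ˣ) : (Matrix n n ℂ)) - 1)]
  have eZ : ((Λb * A₁) * g ^ L * ((g ^ (q ν).toNat)⁻¹ * A₂) : (Matrix n n ℂ)ˣ) = Λb * A₁ * g * A₂ := by
    rw [show (Λb * A₁) * g ^ L * ((g ^ (q ν).toNat)⁻¹ * A₂) = Λb * A₁ * (g ^ L * (g ^ (q ν).toNat)⁻¹) * A₂ by group,
      hgL]
  have step3 : ‖((Λb * A₁ * g * A₂ : (Matrix n n ℂ)ˣ) : (Matrix n n ℂ)) - ((Λb * A₁ * 1 * A₂ : (Matrix n n ℂ)ˣ) : (Matrix n n ℂ))‖ ≤ a₀ := by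
    rw [norm_val_frame_sub ((unitaryUnits (Matrix n n ℂ)).mul_mem huΛb huA₁) huA₂, Units.val_one]
    exact ha _ _ _ hμν
  have step4 : ‖((Λb * A₁ * 1 * A₂ : (Matrix n n ℂ)ˣ) : (Matrix n n ℂ)) - ((Λb * At₁ * At₂ : (Matrix n n ℂ)ˣ) : (Matrix n n ℂ))‖ ≤ d * ((L - 1 : ℕ) * δ) := by
    rw [show (Λb * A₁ * 1 * A₂ : (Matrix n n ℂ)ˣ) = Λb * (A₁ * A₂) by group, show (Λb * At₁ * At₂ : (Matrix n n ℂ)ˣ) = Λb * (At₁ * At₂) by group,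
      norm_val_mul_left_sub huΛb, norm_sub_rev]
    exact hδ₁₂
  -- assemble
  calc ‖((A * (B * Λ') : (Matrix n n ℂ)ˣ) : (Matrix n n ℂ)) - ((B * Λ * (t * As * t⁻¹) : (Matrix n n ℂ)ˣ) : (Matrix n n ℂ))‖
      ≤ ‖((A * (B * Λ') : (Matrix n n ℂ)ˣ) : (Matrix n n ℂ)) - ((B * Λ' * A : (Matrix n n ℂ)ˣ) : (Matrix n n ℂ))‖
        + ‖((B * Λ' * A : (Matrix n n ℂ)ˣ) : (Matrix n n ℂ)) - ((B * Λ * (t * As * t⁻¹) : (Matrix n n ℂ)ˣ) : (Matrix n n ℂ))‖ := norm_sub_le_norm_sub_add_norm_sub _ _ _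
    _ ≤ 2 * θ * (θ + θL) + (2 * (L * a₀) * (θL + θ) + (a₀ + d * ((L - 1 : ℕ) * δ))) := by
        refine add_le_add step1 ?_
        rw [eX, eY, norm_val_mul_left_sub huPre]
        calc ‖((g ^ L * (Λb * A₁) * ((g ^ (q ν).toNat)⁻¹ * A₂) : (Matrix n n ℂ)ˣ) : (Matrix n n ℂ)) - ((Λb * At₁ * At₂ : (Matrix n n ℂ)ˣ) : (Matrix n n ℂ))‖
            ≤ ‖((g ^ L * (Λb * A₁) * ((g ^ (q ν).toNat)⁻¹ * A₂) : (Matrix n n ℂ)ˣ) : (Matrix n n ℂ))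
                - (((Λb * A₁) * g ^ L * ((g ^ (q ν).toNat)⁻¹ * A₂) : (Matrix n n ℂ)ˣ) : (Matrix n n ℂ))‖
              + ‖(((Λb * A₁) * g ^ L * ((g ^ (q ν).toNat)⁻¹ * A₂) : (Matrix n n ℂ)ˣ) : (Matrix n n ℂ)) - ((Λb * At₁ * At₂ : (Matrix n n ℂ)ˣ) : (Matrix n n ℂ))‖ :=
              norm_sub_le_norm_sub_add_norm_sub _ _ _
          _ ≤ 2 * (L * a₀) * (θL + θ) + (a₀ + d * ((L - 1 : ℕ) * δ)) := by
              refine add_le_add step2 ?_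
              rw [eZ]
              exact (norm_sub_le_norm_sub_add_norm_sub _ _ _).trans (add_le_add step3 step4)
    _ = _ := by rw [hθdef, hθLdef]; ring

end CaseIII

end

end Summit.QuantumFields.BalabanUV.T4Continuum.SkeletonFillFullFaces
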